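import Summits.CriticalPhenomena.PercolationContinuityZ3.Theorems.PercNearOneGluingNoHeavyRsw3InvasionSparseMarks
import Summits.CriticalPhenomena.PercolationContinuityZ3.Theorems.PercNearOneGluingNoHeavyRsw3InvasionPonds
import Literature.Probability.Percolation.TwoGhostSpace
import HarnessLib

/-!
# RSW3 lane (P2, gen 27): INVASION PERCOLATION XI — THE OUTLETS HAVE ZERO DENSITY
# (Chayes–Chayes–Newman 1985, Corollary to Thm 3.2 at `y = p_c`: `Q_n(p_c) → 1` almost surely, every `d ≥ 2`)

builds on p205010 (kernel theorem, internal audit signed; external expert review pending) — USED only in §4 (`ae_tendsto_badCount_criticalProb_atTop`,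
`ae_outlets_criticalProb`, `ae_tendsto_card_metCriticalClusters_atTop`), through gen 26's `ae_frequently_criticalProb_lt_acceptedLabel`; §1–§3 do not use it.

Cell `prim-rsw3`, prover seat `prim-rsw3-p2` (gen 27), memo `run/shared/lean/prim/rsw3/P2-RSWLITE.md` §34.  Support file
(`--supports stmt-CriticalPhenomena-4575`); no definitions, no named facts, no sorries.  `μ = labelMeasure`, `x_n = acceptedLabel`,
`M_n(y) = badCount … y n = #{k < n : x_k > y}` (CCN's notation), `I_n = invasion … n`, `η_y = configOfLabels y U G`, `C_y(x) = openCluster η_y x`.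

An OUTLET of the invasion at level `y` is a step `k` with `x_k > y`: the invasion has exhausted every `y`-cluster it touches and breaks into a
new one through a `y`-closed bond.  §1 makes this precise on every infinite connected graph: **the number of distinct `y`-clusters met by
`I_n` is exactly `M_n(y) + 1`** (`card_image_openCluster_invasion`).  §2–§3 prove CCN's Corollary "`Q_n(y) → 1` for all `y ≥ p_c`" for the
invasion of `ℤ^d`, `d ≥ 2`: **`M_n(p_c)/n → 0` almost surely** (`ae_tendsto_badCount_criticalProb_div_zero`) — CCN derive the case `y = p_c`
from their Proposition 2.1 (checked labels are i.i.d.); here it comes from file X's lattice-animal bound (for every `r`, a.s. at most `n/r` of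
the first `n` accepted labels lie in `(p_c, p_c + (16d4^d)^{-r}]`) and Theorem 3.2 (a.s. only finitely many accepted labels exceed
`p_c + (16d4^d)^{-r}`, gen 26 file IV).  §4 adds p205010: at `p_c(ℤ^d)` itself the outlets are a.s. INFINITE in number (gen 26 file V) yet of
ZERO DENSITY, i.e. **the invasion of `ℤ^d` meets infinitely many critical clusters, `o(n)` of them by time `n`, so their average size
diverges** (`ae_outlets_criticalProb`, `ae_tendsto_card_metCriticalClusters_atTop`, `ae_tendsto_avgMetCriticalClusterSize_atTop`).

References: J. T. Chayes, L. Chayes, C. M. Newman, Comm. Math. Phys. 101 (1985) 383–407, Prop. 2.1 + Cor., Thm 3.2 + Cor., §3 (ii)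
[ChayesChayesNewman1985]; M. Heydenreich, R. van der Hofstad, *Progress in high-dimensional percolation and random graphs* (2017) §16.1.
-/

noncomputable section

namespace Summit.CriticalPhenomena.PercolationContinuityZ3.Theorems.Rsw3

open Finset MeasureTheory Filter Topology Literature.Probability.Percolation Literature.Probability.Percolation.Invasion
open scoped ENNReal Classical

/-! ## §1 The clusters met by the invasion are counted by the outlets (every infinite connected graph) -/

section General

variable {V : Type*} [DecidableEq V] {G : SimpleGraph V} [G.LocallyFinite]

/-- **The number of distinct `y`-clusters met by the invaded region at time `n` is `M_n(y) + 1`** (infinite connected graph, every label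
field, every level `y`): a step with `x_n ≤ y` enters a vertex `y`-joined to the region (no new cluster), a step with `x_n > y` (an OUTLET)
enters a vertex whose `y`-cluster is disjoint from `I_n` — by CCN's cluster-absorption priority, an invaded vertex with a not-yet-absorbed
`y`-cluster forces `x_n ≤ y`. [cite: ChayesChayesNewman1985, §3 (ii) (the stopping times n_k: clusters are absorbed whole)] -/
theorem card_image_openCluster_invasion [Infinite V] (hG : G.Preconnected) (U : Sym2 V → ℝ) (o : V) (y : ℝ) (n : ℕ) :
    ((invasion G U o n).image fun x => openCluster (configOfLabels y U G) x).card = badCount G U o y n + 1 := by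
  induction n with
  | zero => simp [badCount_zero]
  | succ n ih =>
    obtain ⟨a, ha⟩ := exists_newDart_eq_some (U := U) (boundaryDarts_invasion_nonempty hG U o n)
    rw [invasion_succ_of_newDart ha, image_insert, badCount_succ, acceptedLabel_of_eq_some G ha]
    by_cases hlt : y < U s(a.1, a.2)
    · rw [if_pos hlt, card_insert_of_notMem, ih]
      intro hmem
      obtain ⟨v, hv, hveq⟩ := mem_image.1 hmem
      have hreach : a.2 ∈ openCluster (configOfLabels y U G) v := by
        rw [hveq]; exact mem_openCluster_self _ _
      have hnot : ¬ openCluster (configOfLabels y U G) v ⊆ ↑(invasion G U o n) :=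
        fun hsub => snd_not_mem_of_newDart ha (Finset.mem_coe.1 (hsub hreach))
      have hle := acceptedLabel_le_of_openCluster_not_subset hv hnot
      rw [acceptedLabel_of_eq_some G ha] at hle
      exact absurd hle (not_le.2 hlt)
    · rw [if_neg hlt, add_zero, ← ih]
      have hle : U s(a.1, a.2) ≤ y := not_lt.1 hlt
      have hadj := openGraph_configOfLabels_adj_of_le (adj_of_newDart ha) hle
      rw [openCluster_eq_of_reachable hadj.reachable, insert_eq_of_mem (mem_image_of_mem _ (fst_mem_of_newDart ha))]

/-- `n ↦ M_n(y)` is unbounded as soon as `x_n > y` infinitely often. [cite: ChayesChayesNewman1985, §3 eq. (3.4)] -/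
theorem tendsto_badCount_atTop_of_frequently {U : Sym2 V → ℝ} {o : V} {y : ℝ}
    (h : ∃ᶠ n in atTop, y < acceptedLabel G U o n) : Tendsto (badCount G U o y) atTop atTop := by
  have hstep : ∀ M : ℕ, ∃ N, M ≤ badCount G U o y N := by
    intro M
    induction M with
    | zero => exact ⟨0, Nat.zero_le _⟩
    | succ M ih =>
      obtain ⟨N, hN⟩ := ih
      obtain ⟨n, hn, hlt⟩ := h.forall_exists_of_atTop N
      refine ⟨n + 1, ?_⟩
      rw [badCount_succ, if_pos hlt]
      have := badCount_mono G U o y hn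
      omega
  refine tendsto_atTop_atTop.2 fun M => ?_
  obtain ⟨N, hN⟩ := hstep M
  exact ⟨N, fun n hn => hN.trans (badCount_mono G U o y hn)⟩

/-- `M_n(y)` is antitone in the level: `y ≤ y' ⇒ M_n(y') ≤ M_n(y)`. [cite: ChayesChayesNewman1985, §3 eq. (3.4)] -/
theorem badCount_anti {U : Sym2 V → ℝ} {o : V} {y y' : ℝ} (h : y ≤ y') (n : ℕ) :
    badCount G U o y' n ≤ badCount G U o y n :=
  card_le_card (fun k hk => by
    rw [mem_filter] at hk ⊢
    exact ⟨hk.1, h.trans_lt hk.2⟩)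

/-- `M_n(y) ≤ n`. [cite: ChayesChayesNewman1985, §3 eq. (3.4)] -/
theorem badCount_le {U : Sym2 V → ℝ} {o : V} {y : ℝ} (n : ℕ) : badCount G U o y n ≤ n :=
  (card_filter_le _ _).trans (card_range n).le

/-- Splitting the outlets at an intermediate level: `M_n(y) ≤ #{k < n : x_k ∈ (y, y']} + M_n(y')`. [cite: ChayesChayesNewman1985, §3 eq. (3.4)] -/
theorem badCount_le_card_filter_add {U : Sym2 V → ℝ} {o : V} (y y' : ℝ) (n : ℕ) :
    badCount G U o y n ≤ ((Finset.range n).filter fun k => acceptedLabel G U o k ∈ Set.Ioc y y').card + badCount G U o y' n := by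
  unfold badCount
  rw [← card_union_of_disjoint]
  · refine card_le_card fun k hk => ?_
    rw [mem_filter] at hk
    rw [mem_union, mem_filter, mem_filter]
    by_cases h : acceptedLabel G U o k ≤ y'
    · exact Or.inl ⟨hk.1, hk.2, h⟩
    · exact Or.inr ⟨hk.1, not_le.1 h⟩
  · rw [disjoint_filter]
    intro k _ h1 h2
    exact absurd h1.2 (not_le.2 h2)

end General

/-! ## §2 A real-variable lemma: `r·b_n ≤ n + C_r` for every `r` forces `b_n / n → 0` -/

/-- If for every `r ≥ 1` eventually `r · b_n ≤ n + C_r`, with `b_n ≥ 0`, then `b_n / n → 0`. [folklore] -/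
theorem tendsto_div_zero_of_forall_mul_le {b : ℕ → ℝ} (hb : ∀ n, 0 ≤ b n)
    (h : ∀ r : ℕ, 0 < r → ∃ C : ℝ, ∀ᶠ n in atTop, (r : ℝ) * b n ≤ n + C) :
    Tendsto (fun n => b n / n) atTop (𝓝 0) := by
  refine Metric.tendsto_atTop.2 fun ε hε => ?_
  obtain ⟨r, hr⟩ := exists_nat_gt (2 / ε)
  have hrpos : (0 : ℝ) < r := lt_trans (by positivity) hr
  obtain ⟨C, hC⟩ := h r (by exact_mod_cast hrpos)
  obtain ⟨N, hN⟩ := eventually_atTop.1 (hC.and ((tendsto_natCast_atTop_atTop.eventually_ge_atTop |C|).and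
    (eventually_gt_atTop 0)))
  refine ⟨N, fun n hn => ?_⟩
  obtain ⟨h1, h2, h3⟩ := hN n hn
  have hn0 : (0 : ℝ) < n := by exact_mod_cast h3
  rw [Real.dist_eq, sub_zero, abs_of_nonneg (div_nonneg (hb n) hn0.le), div_lt_iff₀ hn0]
  -- `r b_n ≤ n + C ≤ 2n < r ε n`
  have h4 : (r : ℝ) * b n ≤ 2 * n := by linarith [le_abs_self C]
  have h5 : 2 * (n : ℝ) < r * (ε * n) := by
    have := (div_lt_iff₀ hε).1 hr
    nlinarith
  exact lt_of_mul_lt_mul_left (h4.trans_lt h5) hrpos.le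

/-! ## §3 The outlets of the invasion of `ℤ^d` have zero density (CCN's Corollary: `Q_n(y) → 1` for every `y ≥ p_c`) -/

section Zd

open Literature.Probability.LatticeModels

variable {d : ℕ}

/-- **The outlets near `p_c` are sparse**: for every `r ≥ 1` there is (a.s.) a constant `C` with `r · M_n(p_c) ≤ n + C` for all large `n`
(`d ≥ 2`).  Split `M_n(p_c) ≤ #{k < n : x_k ∈ (p_c, p_c + ε_r]} + M_n(p_c + ε_r)` with `ε_r = (16d4^d)^{-r}`: the first count is `≤ n/r`
for large `n` (file X, lattice animals), the second is eventually constant (Thm 3.2, gen 26 file IV).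
[cite: ChayesChayesNewman1985, Corollary to Thm 3.2 (proof for y = p_c via the Corollary to Prop. 2.1)] -/
theorem ae_forall_eventually_mul_badCount_criticalProb_le (hd : 2 ≤ d) :
    ∀ᵐ U ∂(labelMeasure (Site d)), ∀ r : ℕ, 0 < r → ∃ C : ℕ, ∀ᶠ n in atTop,
      r * badCount (zdGraph d) U 0 (criticalProb (zdGraph d) (0 : Site d)) n ≤ n + C := by
  haveI : NeZero d := ⟨by omega⟩
  set pc : ℝ := criticalProb (zdGraph d) (0 : Site d) with hpc
  have hpc1 : pc < 1 := criticalProb_zd_lt_one hd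
  have hpc0 : 0 ≤ pc := (criticalProb_mem_Icc _ _).1
  set c : ℝ := 1 / (16 * d * 4 ^ d) with hc
  have hcpos : 0 < c := by rw [hc]; positivity
  -- the levels `y r = min (p_c + c^r) 1 > p_c`
  have hy : ∀ r : ℕ, ∃ y : unitInterval, pc < y ∧ (y : ℝ) ≤ pc + c ^ r := by
    intro r
    refine ⟨⟨min (pc + c ^ r) 1, le_min (by positivity) zero_le_one, min_le_right _ _⟩,
      lt_min (by have := pow_pos hcpos r; linarith) hpc1, min_le_left _ _⟩
  choose y hy1 hy2 using hy
  -- the two almost sure inputs, for every `r`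
  have hsmall : ∀ r : ℕ, volume.restrict (Set.Icc (0 : ℝ) 1) (Set.Ioc pc (pc + c ^ r))
      ≤ ENNReal.ofReal ((1 / (16 * d * 4 ^ d)) ^ r) := by
    intro r
    calc volume.restrict (Set.Icc (0 : ℝ) 1) (Set.Ioc pc (pc + c ^ r)) ≤ volume (Set.Ioc pc (pc + c ^ r)) :=
          Measure.le_iff'.1 Measure.restrict_le_self _
      _ = ENNReal.ofReal ((1 / (16 * d * 4 ^ d)) ^ r) := by rw [Real.volume_Ioc, ← hc]; ring_nf
  have hA := fun (r : ℕ) (hr : 0 < r) =>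
    ae_eventually_mul_card_filter_acceptedLabel_mem_le_zd (d := d) (J := Set.Ioc pc (pc + c ^ r)) (by omega) hr
      measurableSet_Ioc (hsmall r)
  have hB : ∀ r : ℕ, ∀ᵐ U ∂(labelMeasure (Site d)), {n | (y r : ℝ) < acceptedLabel (zdGraph d) U 0 n}.Finite := fun r =>
    ae_finite_setOf_lt_acceptedLabel (by omega) (y r) (theta_halfSpace_pos_of_criticalProb_lt hd (y r) (hy1 r))
  have hA' : ∀ᵐ U ∂(labelMeasure (Site d)), ∀ r : ℕ, 0 < r → ∀ᶠ n in atTop,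
      r * ((Finset.range (n + 1)).filter fun k => acceptedLabel (zdGraph d) U 0 k ∈ Set.Ioc pc (pc + c ^ r)).card ≤ n :=
    ae_all_iff.2 fun r : ℕ => Filter.eventually_imp_distrib_left.2 (hA r)
  filter_upwards [hA', ae_all_iff.2 hB] with U hUA hUB r hr
  have hfin := hUB r
  refine ⟨r * hfin.toFinset.card, ?_⟩
  filter_upwards [hUA r hr] with n hn
  -- `M_n(p_c) ≤ #{k < n : x_k ∈ (p_c, p_c + c^r]} + M_n(p_c + c^r)` and `M_n(p_c + c^r) ≤ |{k : y_r < x_k}|`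
  have h1 := badCount_le_card_filter_add (G := zdGraph d) (U := U) (o := (0 : Site d)) pc (pc + c ^ r) n
  have h2 : badCount (zdGraph d) U 0 (pc + c ^ r) n ≤ hfin.toFinset.card := by
    refine card_le_card fun k hk => ?_
    rw [mem_filter] at hk
    exact hfin.mem_toFinset.2 (lt_of_le_of_lt (hy2 r) hk.2)
  have h3 : ((Finset.range n).filter fun k => acceptedLabel (zdGraph d) U 0 k ∈ Set.Ioc pc (pc + c ^ r)).card
      ≤ ((Finset.range (n + 1)).filter fun k => acceptedLabel (zdGraph d) U 0 k ∈ Set.Ioc pc (pc + c ^ r)).card :=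
    card_le_card (filter_subset_filter _ (range_subset_range.2 (Nat.le_succ n)))
  calc r * badCount (zdGraph d) U 0 pc n
      ≤ r * (((Finset.range n).filter fun k => acceptedLabel (zdGraph d) U 0 k ∈ Set.Ioc pc (pc + c ^ r)).card
          + hfin.toFinset.card) := Nat.mul_le_mul_left r (h1.trans (Nat.add_le_add_left h2 _))
    _ = r * ((Finset.range n).filter fun k => acceptedLabel (zdGraph d) U 0 k ∈ Set.Ioc pc (pc + c ^ r)).card
          + r * hfin.toFinset.card := Nat.mul_add r _ _
    _ ≤ n + r * hfin.toFinset.card := Nat.add_le_add_right ((Nat.mul_le_mul_left r h3).trans hn) _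

/-- **THE OUTLETS OF THE INVASION HAVE ZERO DENSITY: `M_n(p_c)/n → 0` almost surely** (`ℤ^d`, `d ≥ 2`) — Chayes–Chayes–Newman's Corollary
"`Q_n(p_c) → 1` with probability 1" for the tree's invasion, proved without their Proposition 2.1.
[cite: ChayesChayesNewman1985, Corollary to Thm 3.2 (Q_n(y) → 1 for all y ≥ p_c)] -/
theorem ae_tendsto_badCount_criticalProb_div_zero (hd : 2 ≤ d) :
    ∀ᵐ U ∂(labelMeasure (Site d)), Tendsto (fun n : ℕ =>
      (badCount (zdGraph d) U 0 (criticalProb (zdGraph d) (0 : Site d)) n : ℝ) / n) atTop (𝓝 0) := by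
  filter_upwards [ae_forall_eventually_mul_badCount_criticalProb_le hd] with U hU
  refine tendsto_div_zero_of_forall_mul_le (fun n => Nat.cast_nonneg _) fun r hr => ?_
  obtain ⟨C, hC⟩ := hU r hr
  refine ⟨C, ?_⟩
  filter_upwards [hC] with n hn
  exact_mod_cast hn

/-- **The mean number of outlets is `o(n)`: `E[M_n(p_c)]/n → 0`** (`d ≥ 2`; dominated convergence from the a.s. statement, `M_n ≤ n`).
[cite: ChayesChayesNewman1985, §6 (6.1)–(6.3) (B_n(y) = P(x_n > y), E(1 − X_n(y)) → 0)] -/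
theorem tendsto_integral_badCount_criticalProb_div_zero (hd : 2 ≤ d) :
    Tendsto (fun n : ℕ => ∫ U, (badCount (zdGraph d) U 0 (criticalProb (zdGraph d) (0 : Site d)) n : ℝ) / n
      ∂(labelMeasure (Site d))) atTop (𝓝 0) := by
  haveI : IsProbabilityMeasure (labelMeasure (Site d)) := isProbabilityMeasure_labelMeasure _
  have h := tendsto_integral_of_dominated_convergence (μ := labelMeasure (Site d)) (bound := fun _ => (1 : ℝ))
    (F := fun (n : ℕ) (U : Sym2 (Site d) → ℝ) => (badCount (zdGraph d) U 0 (criticalProb (zdGraph d) (0 : Site d)) n : ℝ) / n)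
    (f := fun _ => (0 : ℝ)) (fun n => ((measurable_from_nat.comp (measurable_badCount (G := zdGraph d) 0 _ n)).div_const _).aestronglyMeasurable)
    (integrable_const _) (fun n => Eventually.of_forall fun U => ?_) (ae_tendsto_badCount_criticalProb_div_zero hd)
  · simpa using h
  · rw [Real.norm_eq_abs, abs_of_nonneg (by positivity)]
    rcases Nat.eq_zero_or_pos n with hn | hn
    · simp [hn]
    · rw [div_le_one (by exact_mod_cast hn)]
      exact_mod_cast badCount_le n

/-- **CCN's outlet probabilities `B_k(p_c) = P(x_k > p_c)` vanish in Cesàro mean**: `(1/n) Σ_{k<n} P(x_k > p_c) → 0` (`d ≥ 2`) — although,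
by p205010, a.s. `x_k > p_c` for infinitely many `k` (gen 26 file V). [cite: ChayesChayesNewman1985, §6 (6.1)–(6.3) and the closing remark on y = p_c] -/
theorem tendsto_avg_real_criticalProb_lt_acceptedLabel_zero (hd : 2 ≤ d) :
    Tendsto (fun n : ℕ => (∑ k ∈ Finset.range n,
      (labelMeasure (Site d)).real {U | criticalProb (zdGraph d) (0 : Site d) < acceptedLabel (zdGraph d) U 0 k}) / n) atTop (𝓝 0) := by
  haveI : IsProbabilityMeasure (labelMeasure (Site d)) := isProbabilityMeasure_labelMeasure _
  refine (tendsto_congr fun n => ?_).1 (tendsto_integral_badCount_criticalProb_div_zero hd)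
  have hmeas : ∀ k, MeasurableSet {U : Sym2 (Site d) → ℝ |
      criticalProb (zdGraph d) (0 : Site d) < acceptedLabel (zdGraph d) U 0 k} :=
    fun k => measurableSet_setOf.2 (measurable_lt_acceptedLabel 0 _ k)
  have hpt : ∀ U : Sym2 (Site d) → ℝ, (badCount (zdGraph d) U 0 (criticalProb (zdGraph d) (0 : Site d)) n : ℝ)
      = ∑ k ∈ Finset.range n, ({U : Sym2 (Site d) → ℝ |
          criticalProb (zdGraph d) (0 : Site d) < acceptedLabel (zdGraph d) U 0 k}).indicator (fun _ => (1 : ℝ)) U := by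
    intro U
    unfold badCount
    rw [Finset.card_filter]
    push_cast
    refine Finset.sum_congr rfl fun k _ => ?_
    by_cases h : criticalProb (zdGraph d) (0 : Site d) < acceptedLabel (zdGraph d) U 0 k
    · rw [if_pos h, Set.indicator_of_mem (by exact h)]
    · rw [if_neg h, Set.indicator_of_notMem (by exact h)]
  have hint : ∀ k, Integrable (({U : Sym2 (Site d) → ℝ |
      criticalProb (zdGraph d) (0 : Site d) < acceptedLabel (zdGraph d) U 0 k}).indicator fun _ => (1 : ℝ)) (labelMeasure (Site d)) :=
    fun k => (integrable_const (1 : ℝ)).indicator (hmeas k)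
  simp_rw [div_eq_mul_inv]
  rw [integral_mul_const]
  congr 1
  simp_rw [hpt]
  rw [integral_finsetSum _ fun k _ => hint k]
  exact Finset.sum_congr rfl fun k _ => integral_indicator_one (hmeas k)

/-- **`M_n(y)/n → 0` almost surely for EVERY level `y ≥ p_c(ℤ^d)`** (`d ≥ 2`; `M_n` is antitone in the level).
[cite: ChayesChayesNewman1985, Corollary to Thm 3.2] -/
theorem ae_tendsto_badCount_div_zero_of_criticalProb_le (hd : 2 ≤ d) {y : ℝ} (hy : criticalProb (zdGraph d) (0 : Site d) ≤ y) :
    ∀ᵐ U ∂(labelMeasure (Site d)), Tendsto (fun n : ℕ => (badCount (zdGraph d) U 0 y n : ℝ) / n) atTop (𝓝 0) := by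
  filter_upwards [ae_tendsto_badCount_criticalProb_div_zero hd] with U hU
  refine squeeze_zero (fun n => by positivity) (fun n => ?_) hU
  exact div_le_div_of_nonneg_right (by exact_mod_cast badCount_anti hy n) (Nat.cast_nonneg _)

/-- **CCN's Corollary as printed: the empirical distribution function of the accepted labels satisfies `Q_n(y) → 1` almost surely, for
every `y ≥ p_c(ℤ^d)`** (`d ≥ 2`): `#{k < n : x_k ≤ y}/n → 1`. [cite: ChayesChayesNewman1985, Corollary to Thm 3.2 (∀ y ≥ p_c, Q_n(y) → 1 with probability 1)] -/
theorem ae_tendsto_empiricalCDF_one_of_criticalProb_le (hd : 2 ≤ d) {y : ℝ} (hy : criticalProb (zdGraph d) (0 : Site d) ≤ y) :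
    ∀ᵐ U ∂(labelMeasure (Site d)), Tendsto (fun n : ℕ =>
      (((Finset.range n).filter fun k => acceptedLabel (zdGraph d) U 0 k ≤ y).card : ℝ) / n) atTop (𝓝 1) := by
  filter_upwards [ae_tendsto_badCount_div_zero_of_criticalProb_le hd hy] with U hU
  have hsum : ∀ n : ℕ, (((Finset.range n).filter fun k => acceptedLabel (zdGraph d) U 0 k ≤ y).card : ℝ)
      = n - badCount (zdGraph d) U 0 y n := by
    intro n
    have h := Finset.card_filter_add_card_filter_not (s := Finset.range n) (fun k => acceptedLabel (zdGraph d) U 0 k ≤ y)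
    rw [card_range] at h
    have h' : ((Finset.range n).filter fun k => ¬ acceptedLabel (zdGraph d) U 0 k ≤ y) = (Finset.range n).filter
        fun k => y < acceptedLabel (zdGraph d) U 0 k := by
      simp only [not_le]
    rw [h'] at h
    unfold badCount
    have : (((Finset.range n).filter fun k => acceptedLabel (zdGraph d) U 0 k ≤ y).card : ℝ) +
        ((Finset.range n).filter fun k => y < acceptedLabel (zdGraph d) U 0 k).card = n := by exact_mod_cast h
    linarith
  have h1 : Tendsto (fun n : ℕ => (1 : ℝ) - (badCount (zdGraph d) U 0 y n : ℝ) / n) atTop (𝓝 1) := by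
    simpa using hU.const_sub 1
  refine (tendsto_congr' ?_).1 h1
  filter_upwards [eventually_ge_atTop 1] with n hn
  have hn' : (n : ℝ) ≠ 0 := by exact_mod_cast (show n ≠ 0 by omega)
  rw [hsum, sub_div, div_self hn']

/-- **The number of distinct `y`-clusters met by the invasion of `ℤ^d` by time `n` is `o(n)`, almost surely, for every `y ≥ p_c`** (`d ≥ 2`):
`#{C_y(x) : x ∈ I_n} / (n + 1) → 0`. [cite: ChayesChayesNewman1985, §3 (ii) and Corollary to Thm 3.2] -/
theorem ae_tendsto_card_metClusters_div_zero (hd : 2 ≤ d) {y : ℝ} (hy : criticalProb (zdGraph d) (0 : Site d) ≤ y) :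
    ∀ᵐ U ∂(labelMeasure (Site d)), Tendsto (fun n : ℕ =>
      (((invasion (zdGraph d) U 0 n).image fun x => openCluster (configOfLabels y U (zdGraph d)) x).card : ℝ) / ((n : ℝ) + 1))
        atTop (𝓝 0) := by
  haveI : Nonempty (Fin d) := ⟨⟨0, by omega⟩⟩
  haveI : Infinite (Site d) := Pi.infinite_of_right
  filter_upwards [ae_tendsto_badCount_div_zero_of_criticalProb_le hd hy] with U hU
  have heq : ∀ n : ℕ, (((invasion (zdGraph d) U 0 n).image fun x => openCluster (configOfLabels y U (zdGraph d)) x).card : ℝ)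
      = badCount (zdGraph d) U 0 y n + 1 := fun n => by
    exact_mod_cast card_image_openCluster_invasion zdGraph_preconnected_holds U 0 y n
  simp_rw [heq]
  -- `(M_n + 1)/(n + 1) ≤ M_n/n + 1/(n+1)` for `n ≥ 1`
  have h1 : Tendsto (fun n : ℕ => (badCount (zdGraph d) U 0 y n : ℝ) / n + 1 / ((n : ℝ) + 1)) atTop (𝓝 0) := by
    simpa using hU.add tendsto_one_div_add_atTop_nhds_zero_nat
  refine squeeze_zero' (Eventually.of_forall fun n => by positivity) ?_ h1
  filter_upwards [eventually_ge_atTop 1] with n hn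
  have hn0 : (0 : ℝ) < n := by exact_mod_cast hn
  rw [add_div]
  gcongr ?_ + _
  exact div_le_div_of_nonneg_left (Nat.cast_nonneg _) hn0 (by linarith)

end Zd

/-! ## §4 With p205010: infinitely many outlets at `p_c(ℤ^d)`, of zero density -/

section Critical

open Literature.Probability.LatticeModels

variable {d : ℕ}

/-- **`M_n(p_c) → ∞` almost surely** (`d ≥ 2`, via p205010): the invasion of `ℤ^d` accepts a label `> p_c` infinitely often (gen 26 file V).
[cite: ChayesChayesNewman1985, Thm 3.2 and §3 (ii)] -/
theorem ae_tendsto_badCount_criticalProb_atTop (hd : 2 ≤ d) :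
    ∀ᵐ U ∂(labelMeasure (Site d)), Tendsto (badCount (zdGraph d) U 0 (criticalProb (zdGraph d) (0 : Site d))) atTop atTop := by
  filter_upwards [ae_frequently_criticalProb_lt_acceptedLabel hd] with U hU
  exact tendsto_badCount_atTop_of_frequently hU

/-- **THE OUTLETS OF THE INVASION OF `ℤ^d` AT `p_c`: INFINITELY MANY, OF ZERO DENSITY** (`d ≥ 2`): almost surely `M_n(p_c) → ∞` (p205010:
all critical clusters are finite, so the invasion leaves them again and again) and `M_n(p_c)/n → 0` (this file).  For `y > p_c` the count
`M_n(y)` is a.s. eventually constant (gen 26 file IV), for `y < p_c` it is a.s. unbounded (file IV): the critical level is the unique one with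
infinitely many but density-zero outlets. [cite: ChayesChayesNewman1985, Thm 3.2, its Corollary, and Thm 5.2 discussion] -/
theorem ae_outlets_criticalProb (hd : 2 ≤ d) :
    ∀ᵐ U ∂(labelMeasure (Site d)),
      Tendsto (badCount (zdGraph d) U 0 (criticalProb (zdGraph d) (0 : Site d))) atTop atTop ∧
      Tendsto (fun n : ℕ => (badCount (zdGraph d) U 0 (criticalProb (zdGraph d) (0 : Site d)) n : ℝ) / n) atTop (𝓝 0) := by
  filter_upwards [ae_tendsto_badCount_criticalProb_atTop hd, ae_tendsto_badCount_criticalProb_div_zero hd] with U h1 h2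
  exact ⟨h1, h2⟩

/-- **The invasion of `ℤ^d` meets infinitely many distinct CRITICAL clusters — their number by time `n` tends to infinity — almost surely**
(`d ≥ 2`, via p205010), in the counted form `#{C_{p_c}(x) : x ∈ I_n} = M_n(p_c) + 1 → ∞`. [cite: ChayesChayesNewman1985, §3 (ii) and §5] -/
theorem ae_tendsto_card_metCriticalClusters_atTop (hd : 2 ≤ d) :
    ∀ᵐ U ∂(labelMeasure (Site d)), Tendsto (fun n : ℕ =>
      ((invasion (zdGraph d) U 0 n).image fun x =>
        openCluster (configOfLabels (criticalProb (zdGraph d) (0 : Site d)) U (zdGraph d)) x).card) atTop atTop := by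
  haveI : Nonempty (Fin d) := ⟨⟨0, by omega⟩⟩
  haveI : Infinite (Site d) := Pi.infinite_of_right
  filter_upwards [ae_tendsto_badCount_criticalProb_atTop hd] with U hU
  simp_rw [card_image_openCluster_invasion zdGraph_preconnected_holds U 0 _]
  exact tendsto_atTop_mono (fun n => Nat.le_add_right _ 1) hU

/-- **THE CRITICAL CLUSTERS SWALLOWED BY THE INVASION HAVE DIVERGING AVERAGE SIZE**, almost surely (`ℤ^d`, `d ≥ 2`): the `n + 1` invaded
vertices at time `n` lie in `M_n(p_c) + 1 = o(n)` distinct critical clusters, so `(n + 1) / #{C_{p_c}(x) : x ∈ I_n} → ∞` — the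
self-organised counterpart of `E_{p_c}|C(0)| = ∞`. [cite: ChayesChayesNewman1985, Corollary to Thm 3.2 and §5 (the invaded region resembles critical percolation)] -/
theorem ae_tendsto_avgMetCriticalClusterSize_atTop (hd : 2 ≤ d) :
    ∀ᵐ U ∂(labelMeasure (Site d)), Tendsto (fun n : ℕ => ((n : ℝ) + 1) /
      ((invasion (zdGraph d) U 0 n).image fun x =>
        openCluster (configOfLabels (criticalProb (zdGraph d) (0 : Site d)) U (zdGraph d)) x).card) atTop atTop := by
  filter_upwards [ae_tendsto_card_metClusters_div_zero hd le_rfl] with U hU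
  set f : ℕ → ℝ := fun n => (((invasion (zdGraph d) U 0 n).image fun x =>
      openCluster (configOfLabels (criticalProb (zdGraph d) (0 : Site d)) U (zdGraph d)) x).card : ℝ) / ((n : ℝ) + 1) with hf
  have hpos : ∀ n : ℕ, 0 < f n := fun n => by
    have hne := (Finset.image_nonempty.2 ⟨_, root_mem_invasion U (0 : Site d) n⟩ :
      ((invasion (zdGraph d) U 0 n).image fun x =>
        openCluster (configOfLabels (criticalProb (zdGraph d) (0 : Site d)) U (zdGraph d)) x).Nonempty)
    have hc : (0 : ℝ) < (((invasion (zdGraph d) U 0 n).image fun x =>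
        openCluster (configOfLabels (criticalProb (zdGraph d) (0 : Site d)) U (zdGraph d)) x).card : ℝ) := by
      exact_mod_cast hne.card_pos
    rw [hf]; exact div_pos hc (by positivity)
  have h := tendsto_inv_nhdsGT_zero.comp (tendsto_nhdsWithin_iff.2 ⟨hU, Eventually.of_forall hpos⟩)
  refine (tendsto_congr fun n => ?_).1 h
  simp only [Function.comp_apply, hf, inv_div]

end Critical

end Summit.CriticalPhenomena.PercolationContinuityZ3.Theorems.Rsw3

end
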